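import Mathlib
import Literature.Analysis.Fourier.HilbertTransformLineDerivPV
import Summits.NavierStokesRegularity.OSWSelfSimilar.SheetHalfLineIdentity
import HarnessLib

/-!
# The gCLM/OSW MODEL velocity of an odd profile is OUTWARD in Chen's class 3:
# `𝒰 = H[∫₀Ω]` and `𝒰 ≥ 0` on `(0,∞)` when `Ω` is odd with `Ω ≤ 0` on `(0,∞)`

HONEST FRAMING (cell ns-blowup GROUP B «PROFILE SEARCH», zone Z3 = the 1-D viscous gCLM/OSW sheet; human rulings
D-0035/D-0074): **a classical line-Hilbert-transform fact, kernel-checked as the second nonlocal input of the sign law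
`SheetHalfLine.nsLine_trivial_of_nonpos_of_a_neg` (`SheetMomentIdentity.lean`, MODEL side); not Euler, not Navier–Stokes.**

OBJECT. For a profile `Ω : ℝ → ℝ` the MODEL velocity is the odd function `𝒰` with `𝒰′ = HΩ`, `𝒰(0) = 0`
(`H = hilbertTransform` of `Literature/Analysis/Fourier/HilbertTransformLine.lean`, convention `u_x = Hω`). Let
`P(x) = ∫₀ˣ Ω` be the primitive vanishing at `0`.

WHAT IS PROVED (for `Ω` odd, `C¹` with `|Ω′| ≤ M` and the envelope `|Ω(y)| ≤ C/(1+y²)` — the NS-type-line tail class `Ω ~ Aξ⁻²`):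
* `prim_even`, `prim_antitoneOn` — `P` is even, and nonincreasing on `[0,∞)` when `Ω ≤ 0` on `(0,∞)`;
* `integrableOn_symmIntegrand_prim` — the symmetric p.v. integrand `t ↦ (P(x−t) − P(x+t))/t` of `P` is integrable on `(0,∞)` at
  EVERY `x` although `P ∉ L¹` (`P(±∞) = ∫₀^∞ Ω ≠ 0` in general): by evenness `P(x−t) − P(x+t) = −∫_{t−x}^{t+x} Ω = O(|x|C/t²)`;
* `velocity_eq_hilbertTransform_prim` — **`𝒰 = H P` on `ℝ`**: both vanish at `0` (`HP(0) = 0` by evenness) and have the same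
  derivative `HΩ` everywhere, by the tree's p.v. differentiation rule `hasDerivAt_hilbertTransform_of_integrableOn` (`(HP)′ = H[P′]`,
  no global integrability of `P` needed);
* `velocity_nonneg` — **in Chen's class 3 (`Ω` odd, `Ω ≤ 0` on `(0,∞)`) the velocity is OUTWARD: `𝒰(ξ) ≥ 0` for `ξ ≥ 0`**,
  since `𝒰(ξ) = π⁻¹∫₀^∞ (P(|ξ−t|) − P(ξ+t))/t dt` and `|ξ−t| ≤ ξ+t`, `P` antitone on `[0,∞)` — the MODEL analogue of
  `u(x) = π⁻¹∫₀^∞ ω(y) log(|x−y|/(x+y)) dy ≥ 0`; equivalently the transport `a·𝒰` points TOWARD the origin iff `a < 0`;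
* `eq_zero_of_velocity_eq_zero` — strictness: if moreover `𝒰(ξ₀) = 0` at some `ξ₀ > 0` then `P(2ξ₀) = P(0)`, so `Ω ≡ 0` on
  `(0, 2ξ₀)` and in particular `Ω(ξ₀) = 0`.
All statements are classical consequences of `u_x = Hω` for odd data (Chen 2020 Remark 1.4 records `u_x(0) ≥ 0` in class 3;
Córdoba–Córdoba–Fontelos 2005 use the same monotone-primitive positivity); tagged [folklore]. No definitions.
bears_on: LADDER-NS N5 / zone Z3 clause (i′) (CENSUS-Z3 v2.9 §0) → N1 linear core. WHAT THIS IS NOT: not NS.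
-/

noncomputable section
open Set Filter Topology MeasureTheory
open scoped Real

namespace Summit.NavierStokesRegularity.OSWSelfSimilar
namespace SheetHalfLine
open Literature.Analysis.Fourier

/-! ### The even primitive `P = ∫₀ˣ Ω` of an odd profile -/

/-- `P′ = Ω` for continuous `Ω`. [folklore] -/
theorem prim_hasDerivAt {Om : ℝ → ℝ} (hc : Continuous Om) (x : ℝ) :
    HasDerivAt (fun x => ∫ u in (0:ℝ)..x, Om u) (Om x) x :=
  (hc.integral_hasStrictDerivAt 0 x).hasDerivAt

/-- The primitive of an odd function vanishing-based at `0` is even: `P(−x) = P(x)`. [folklore] -/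
theorem prim_even {Om : ℝ → ℝ} (hodd : ∀ y, Om (-y) = -Om y) (x : ℝ) :
    (∫ u in (0:ℝ)..(-x), Om u) = ∫ u in (0:ℝ)..x, Om u := by
  have h1 : (∫ u in (0:ℝ)..x, Om (-u)) = ∫ u in (-x)..(-0), Om u := intervalIntegral.integral_comp_neg _
  have h2 : (∫ u in (0:ℝ)..x, Om (-u)) = -∫ u in (0:ℝ)..x, Om u := by
    simp_rw [hodd]
    exact intervalIntegral.integral_neg
  simp only [neg_zero] at h1
  have h3 : (∫ u in (-x)..0, Om u) = -∫ u in (0:ℝ)..(-x), Om u := intervalIntegral.integral_symm _ _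
  linarith

/-- `|P(b) − P(a)| ≤ C|b − a|` when `|Ω| ≤ C`. [folklore] -/
theorem abs_prim_sub_prim_le {Om : ℝ → ℝ} {C : ℝ} (hc : Continuous Om) (hC : ∀ y, |Om y| ≤ C) (a b : ℝ) :
    |(∫ u in (0:ℝ)..b, Om u) - ∫ u in (0:ℝ)..a, Om u| ≤ C * |b - a| := by
  have hsub : (∫ u in (0:ℝ)..b, Om u) - (∫ u in (0:ℝ)..a, Om u) = ∫ u in a..b, Om u :=
    intervalIntegral.integral_interval_sub_left (hc.intervalIntegrable _ _) (hc.intervalIntegrable _ _)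
  have h := intervalIntegral.norm_integral_le_of_norm_le_const (f := Om) (a := a) (b := b) (C := C)
    (fun y _ => by rw [Real.norm_eq_abs]; exact hC y)
  rw [Real.norm_eq_abs] at h
  rw [hsub]
  exact h

/-- In class 3 (`Ω ≤ 0` on `(0,∞)`) the primitive is nonincreasing on `[0,∞)`. [folklore] -/
theorem prim_antitoneOn {Om : ℝ → ℝ} (hc : Continuous Om) (hsign : ∀ ξ ∈ Ioi (0:ℝ), Om ξ ≤ 0) :
    AntitoneOn (fun x => ∫ u in (0:ℝ)..x, Om u) (Ici 0) := by
  refine antitoneOn_of_deriv_nonpos (convex_Ici 0) ?_ ?_ ?_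
  · exact (continuous_iff_continuousAt.mpr fun x => (prim_hasDerivAt hc x).continuousAt).continuousOn
  · exact fun x _ => (prim_hasDerivAt hc x).differentiableAt.differentiableWithinAt
  · intro x hx
    rw [interior_Ici] at hx
    rw [hc.deriv_integral Om 0 x]
    exact hsign x hx

/-- The pointwise sign behind the outward velocity: for `ξ ≥ 0`, `t ≥ 0` and `Ω ≤ 0` on `(0,∞)` odd,
`P(ξ + t) ≤ P(ξ − t)` (`= P(|ξ − t|)`, and `|ξ − t| ≤ ξ + t`). [folklore] -/
theorem prim_add_le_prim_sub {Om : ℝ → ℝ} (hc : Continuous Om) (hodd : ∀ y, Om (-y) = -Om y)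
    (hsign : ∀ ξ ∈ Ioi (0:ℝ), Om ξ ≤ 0) {ξ t : ℝ} (hξ : 0 ≤ ξ) (ht : 0 ≤ t) :
    (∫ u in (0:ℝ)..(ξ + t), Om u) ≤ ∫ u in (0:ℝ)..(ξ - t), Om u := by
  have hanti := prim_antitoneOn hc hsign
  rcases le_or_gt t ξ with hle | hgt
  · -- ξ − t ≥ 0
    exact hanti (show ξ - t ∈ Ici (0:ℝ) by simp [hle]) (show ξ + t ∈ Ici (0:ℝ) by simp; linarith) (by linarith)
  · -- ξ − t < 0: P(ξ − t) = P(t − ξ)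
    have heven : (∫ u in (0:ℝ)..(ξ - t), Om u) = ∫ u in (0:ℝ)..(t - ξ), Om u := by
      rw [show ξ - t = -(t - ξ) by ring, prim_even hodd]
    rw [heven]
    exact hanti (show t - ξ ∈ Ici (0:ℝ) by simp; linarith) (show ξ + t ∈ Ici (0:ℝ) by simp; linarith) (by linarith)

/-! ### The symmetric p.v. integrand of `P` is integrable at every base point -/

/-- By evenness, `P(x − t) − P(x + t) = −∫_{t−x}^{t+x} Ω`. [folklore] -/
theorem prim_symm_eq {Om : ℝ → ℝ} (hc : Continuous Om) (hodd : ∀ y, Om (-y) = -Om y) (x t : ℝ) :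
    (∫ u in (0:ℝ)..(x - t), Om u) - (∫ u in (0:ℝ)..(x + t), Om u) = -∫ u in (t - x)..(t + x), Om u := by
  have heven : (∫ u in (0:ℝ)..(x - t), Om u) = ∫ u in (0:ℝ)..(t - x), Om u := by
    rw [show x - t = -(t - x) by ring, prim_even hodd]
  have hsub : (∫ u in (0:ℝ)..(t + x), Om u) - (∫ u in (0:ℝ)..(t - x), Om u) = ∫ u in (t - x)..(t + x), Om u :=
    intervalIntegral.integral_interval_sub_left (hc.intervalIntegrable _ _) (hc.intervalIntegrable _ _)
  rw [heven, add_comm x t]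
  linarith

/-- **The symmetric p.v. integrand of `P = ∫₀Ω` is integrable on `(0,∞)` at every `x`** for odd continuous `Ω` with
`|Ω(y)| ≤ C/(1+y²)`: near `t = 0` it is bounded by `2C`, and for `t > |x| + 1` by `2|x|C/(1+(t−|x|)²)`. [folklore] -/
theorem integrableOn_symmIntegrand_prim {Om : ℝ → ℝ} {C : ℝ} (hc : Continuous Om) (hodd : ∀ y, Om (-y) = -Om y)
    (hC : ∀ y, |Om y| ≤ C / (1 + y ^ 2)) (x : ℝ) :
    IntegrableOn (fun t => ((∫ u in (0:ℝ)..(x - t), Om u) - ∫ u in (0:ℝ)..(x + t), Om u) / t) (Ioi 0) := by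
  set P : ℝ → ℝ := fun x => ∫ u in (0:ℝ)..x, Om u with hP
  have hC0 : 0 ≤ C := by
    have h := hC 0
    have : |Om 0| ≤ C := by simpa using h
    exact (abs_nonneg _).trans this
  have hCb : ∀ y, |Om y| ≤ C := fun y => (hC y).trans (div_le_self hC0 (by nlinarith [sq_nonneg y]))
  have cP : Continuous P := continuous_iff_continuousAt.mpr fun y => (prim_hasDerivAt hc y).continuousAt
  -- continuity of the integrand away from t = 0
  have hcont : ContinuousOn (fun t => (P (x - t) - P (x + t)) / t) {t | t ≠ 0} := by
    refine ContinuousOn.div ?_ continuousOn_id fun t ht => ht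
    exact ((cP.comp (continuous_const.sub continuous_id)).sub (cP.comp (continuous_const.add continuous_id))).continuousOn
  set A : ℝ := |x| + 1 with hA
  have hA0 : 0 ≤ A := by positivity
  rw [← Ioc_union_Ioi_eq_Ioi hA0]
  refine IntegrableOn.union ?_ ?_
  · -- near piece: bounded by 2C on (0, A]
    refine IntegrableOn.of_bound measure_Ioc_lt_top
      ((hcont.mono fun t ht => ne_of_gt ht.1).aestronglyMeasurable measurableSet_Ioc) (2 * C) ?_
    refine (ae_restrict_iff' measurableSet_Ioc).mpr (Eventually.of_forall fun t ht => ?_)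
    have ht0 : 0 < t := ht.1
    rw [Real.norm_eq_abs, abs_div, abs_of_pos ht0, div_le_iff₀ ht0]
    have h := abs_prim_sub_prim_le hc hCb (x + t) (x - t)
    rw [show x - t - (x + t) = -(2 * t) by ring, abs_neg, abs_of_pos (by linarith : 0 < 2 * t)] at h
    calc |P (x - t) - P (x + t)| ≤ C * (2 * t) := h
      _ = 2 * C * t := by ring
  · -- far piece: for t > |x| + 1, |P(x−t) − P(x+t)| = |∫_{t−x}^{t+x} Ω| ≤ 2|x| C/(1+(t−|x|)²), and 1/t ≤ 1
    have hg : Integrable fun t : ℝ => 2 * |x| * C * (1 + (t - |x|) ^ 2)⁻¹ :=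
      (integrable_inv_one_add_sq.comp_sub_right |x|).const_mul (2 * |x| * C)
    refine Integrable.mono' hg.integrableOn
      ((hcont.mono fun t ht => ne_of_gt (lt_of_le_of_lt hA0 ht)).aestronglyMeasurable measurableSet_Ioi) ?_
    refine (ae_restrict_iff' measurableSet_Ioi).mpr (Eventually.of_forall fun t ht => ?_)
    have htA : |x| + 1 < t := ht
    have ht1 : 1 < t := by linarith [abs_nonneg x]
    have ht0 : 0 < t := by linarith
    -- bound of Ω on the integration range Ι (t−x) (t+x) ⊆ [t−|x|, t+|x|]
    have hden : 0 < 1 + (t - |x|) ^ 2 := by positivity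
    have hbound : ∀ y ∈ Set.uIoc (t - x) (t + x), ‖Om y‖ ≤ C / (1 + (t - |x|) ^ 2) := by
      intro y hy
      rw [Real.norm_eq_abs]
      rw [Set.uIoc, Set.mem_Ioc] at hy
      have hmin : t - |x| ≤ min (t - x) (t + x) := by
        rcases le_or_gt 0 x with hx | hx
        · rw [abs_of_nonneg hx]; exact le_min le_rfl (by linarith)
        · rw [abs_of_neg hx]; exact le_min (by linarith) (by linarith)
      have hy1 : t - |x| ≤ y := hmin.trans hy.1.le
      have hy0 : 0 ≤ t - |x| := by linarith
      have hsq : (t - |x|) ^ 2 ≤ y ^ 2 := by nlinarith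
      calc |Om y| ≤ C / (1 + y ^ 2) := hC y
        _ ≤ C / (1 + (t - |x|) ^ 2) := by
          apply div_le_div_of_nonneg_left hC0 hden
          linarith
    have hint := intervalIntegral.norm_integral_le_of_norm_le_const hbound
    rw [show t + x - (t - x) = 2 * x by ring, Real.norm_eq_abs] at hint
    rw [Real.norm_eq_abs, abs_div, abs_of_pos ht0]
    have hnum : |P (x - t) - P (x + t)| ≤ C / (1 + (t - |x|) ^ 2) * |2 * x| := by
      rw [show P (x - t) - P (x + t) = -∫ u in (t - x)..(t + x), Om u from prim_symm_eq hc hodd x t, abs_neg]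
      exact hint
    have h2x : |2 * x| = 2 * |x| := by rw [abs_mul, abs_of_pos (by norm_num : (0:ℝ) < 2)]
    rw [h2x] at hnum
    have hnn : 0 ≤ |P (x - t) - P (x + t)| := abs_nonneg _
    calc |P (x - t) - P (x + t)| / t ≤ |P (x - t) - P (x + t)| / 1 :=
          div_le_div_of_nonneg_left hnn one_pos ht1.le
      _ ≤ C / (1 + (t - |x|) ^ 2) * (2 * |x|) := by rw [div_one]; exact hnum
      _ = 2 * |x| * C * (1 + (t - |x|) ^ 2)⁻¹ := by rw [div_eq_mul_inv]; ring

/-! ### `𝒰 = H P`, the outward-velocity law and its strictness -/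

/-- **`𝒰 = H[∫₀Ω]`**: for an odd `C¹` profile with `|Ω′| ≤ M`, `|Ω(y)| ≤ C/(1+y²)`, the function `𝒰` with `𝒰′ = HΩ` on `ℝ` and
`𝒰(0) = 0` is the Hilbert transform of the even primitive `P = ∫₀Ω` (p.v. symmetric form, pointwise on `ℝ`).
[folklore] -/
theorem velocity_eq_hilbertTransform_prim {Om dOm U : ℝ → ℝ} {M C : ℝ} (hodd : ∀ y, Om (-y) = -Om y)
    (hOm : ∀ ξ, HasDerivAt Om (dOm ξ) ξ) (hdOmc : Continuous dOm) (hM : ∀ y, |dOm y| ≤ M)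
    (hC : ∀ y, |Om y| ≤ C / (1 + y ^ 2))
    (hU : ∀ ξ, HasDerivAt U (hilbertTransform Om ξ) ξ) (hU0 : U 0 = 0) (ξ : ℝ) :
    U ξ = hilbertTransform (fun x => ∫ u in (0:ℝ)..x, Om u) ξ := by
  set P : ℝ → ℝ := fun x => ∫ u in (0:ℝ)..x, Om u with hP
  have hc : Continuous Om := continuous_iff_continuousAt.mpr fun x => (hOm x).continuousAt
  have hdP : deriv P = Om := funext fun x => (prim_hasDerivAt hc x).deriv
  have hdOm' : deriv Om = dOm := funext fun x => (hOm x).deriv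
  have hdiffP : Differentiable ℝ P := fun x => (prim_hasDerivAt hc x).differentiableAt
  have hdiffOm : Differentiable ℝ Om := fun x => (hOm x).differentiableAt
  -- P is C²
  have hP2 : ContDiff ℝ 2 P := by
    rw [show (2 : WithTop ℕ∞) = 1 + 1 from rfl, contDiff_succ_iff_deriv]
    refine ⟨hdiffP, by simp, ?_⟩
    rw [hdP, contDiff_one_iff_deriv]
    exact ⟨hdiffOm, by rw [hdOm']; exact hdOmc⟩
  have hM' : ∀ y, |deriv (deriv P) y| ≤ M := fun y => by rw [hdP, hdOm']; exact hM y
  have hC' : ∀ y, |deriv P y| ≤ C / (1 + y ^ 2) := fun y => by rw [hdP]; exact hC y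
  -- (HP)′ = HΩ everywhere
  have hHP : ∀ x, HasDerivAt (hilbertTransform P) (hilbertTransform Om x) x := by
    intro x
    have h := hasDerivAt_hilbertTransform_of_integrableOn hP2 hM' hC' (integrableOn_symmIntegrand_prim hc hodd hC x)
    rwa [hdP] at h
  -- HP(0) = 0 by evenness
  have hHP0 : hilbertTransform P 0 = 0 := by
    unfold hilbertTransform
    have h0 : (fun t : ℝ => (P (0 - t) - P (0 + t)) / t) = fun _ => 0 := by
      funext t
      have hev : P (-t) = P t := by
        simp only [hP]
        exact prim_even hodd t
      rw [zero_sub, zero_add, hev, sub_self, zero_div]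
    rw [h0]
    simp
  -- U − HP has zero derivative and vanishes at 0
  have hdiffD : Differentiable ℝ (U - hilbertTransform P) :=
    fun x => ((hU x).sub (hHP x)).differentiableAt
  have hD : ∀ x, deriv (U - hilbertTransform P) x = 0 := fun x => by
    rw [((hU x).sub (hHP x)).deriv, sub_self]
  have h := is_const_of_deriv_eq_zero hdiffD hD ξ 0
  simp only [Pi.sub_apply, hU0, hHP0, sub_zero] at h
  linarith

/-- **OUTWARD VELOCITY IN CLASS 3.** For an odd `C¹` profile with `|Ω′| ≤ M`, `|Ω(y)| ≤ C/(1+y²)` and `Ω ≤ 0` on `(0,∞)`, the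
MODEL velocity (`𝒰′ = HΩ`, `𝒰(0) = 0`) satisfies `𝒰(ξ) ≥ 0` for every `ξ ≥ 0`:
`𝒰(ξ) = π⁻¹ ∫₀^∞ (P(ξ−t) − P(ξ+t))/t dt` with a nonnegative integrand. [folklore] -/
theorem velocity_nonneg {Om dOm U : ℝ → ℝ} {M C : ℝ} (hodd : ∀ y, Om (-y) = -Om y)
    (hOm : ∀ ξ, HasDerivAt Om (dOm ξ) ξ) (hdOmc : Continuous dOm) (hM : ∀ y, |dOm y| ≤ M)
    (hC : ∀ y, |Om y| ≤ C / (1 + y ^ 2))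
    (hU : ∀ ξ, HasDerivAt U (hilbertTransform Om ξ) ξ) (hU0 : U 0 = 0)
    (hsign : ∀ ξ ∈ Ioi (0:ℝ), Om ξ ≤ 0) {ξ : ℝ} (hξ : 0 ≤ ξ) : 0 ≤ U ξ := by
  have hc : Continuous Om := continuous_iff_continuousAt.mpr fun x => (hOm x).continuousAt
  rw [velocity_eq_hilbertTransform_prim hodd hOm hdOmc hM hC hU hU0 ξ]
  unfold hilbertTransform
  refine mul_nonneg (inv_nonneg.mpr Real.pi_pos.le) (setIntegral_nonneg measurableSet_Ioi fun t ht => ?_)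
  have ht : 0 < t := ht
  exact div_nonneg (by linarith [prim_add_le_prim_sub hc hodd hsign hξ ht.le]) ht.le

/-- **Strictness of the outward-velocity law.** In the setting of `velocity_nonneg`, if `𝒰(ξ₀) = 0` at some `ξ₀ > 0`, then
`Ω ≡ 0` on `(0, 2ξ₀)`; in particular `Ω(ξ₀) = 0`. (The nonnegative integrand of `𝒰(ξ₀)` must vanish identically; at `t = ξ₀`
this says `P(2ξ₀) = P(0) = 0`, and `P` is antitone.) [folklore] -/
theorem eq_zero_of_velocity_eq_zero {Om dOm U : ℝ → ℝ} {M C : ℝ} (hodd : ∀ y, Om (-y) = -Om y)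
    (hOm : ∀ ξ, HasDerivAt Om (dOm ξ) ξ) (hdOmc : Continuous dOm) (hM : ∀ y, |dOm y| ≤ M)
    (hC : ∀ y, |Om y| ≤ C / (1 + y ^ 2))
    (hU : ∀ ξ, HasDerivAt U (hilbertTransform Om ξ) ξ) (hU0 : U 0 = 0)
    (hsign : ∀ ξ ∈ Ioi (0:ℝ), Om ξ ≤ 0) {ξ₀ : ℝ} (hξ₀ : 0 < ξ₀) (hUz : U ξ₀ = 0) : Om ξ₀ = 0 := by
  set P : ℝ → ℝ := fun x => ∫ u in (0:ℝ)..x, Om u with hP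
  have hc : Continuous Om := continuous_iff_continuousAt.mpr fun x => (hOm x).continuousAt
  have cP : Continuous P := continuous_iff_continuousAt.mpr fun y => (prim_hasDerivAt hc y).continuousAt
  -- the integral of the nonnegative symmetric integrand vanishes
  have hrepr := velocity_eq_hilbertTransform_prim hodd hOm hdOmc hM hC hU hU0 ξ₀
  rw [hUz] at hrepr
  unfold hilbertTransform at hrepr
  have hint0 : ∫ t in Ioi (0:ℝ), (P (ξ₀ - t) - P (ξ₀ + t)) / t = 0 := by
    have hπ : (π⁻¹ : ℝ) ≠ 0 := inv_ne_zero Real.pi_pos.ne'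
    have := mul_eq_zero.mp hrepr.symm
    rcases this with h | h
    · exact absurd h hπ
    · exact h
  -- so the integrand vanishes on (0,∞)
  have hnn : ∀ t ∈ Ioi (0:ℝ), 0 ≤ (P (ξ₀ - t) - P (ξ₀ + t)) / t := fun t ht => by
    have ht : 0 < t := ht
    exact div_nonneg (by simp only [hP]; linarith [prim_add_le_prim_sub hc hodd hsign hξ₀.le ht.le]) ht.le
  have hconti : ContinuousOn (fun t => (P (ξ₀ - t) - P (ξ₀ + t)) / t) (Ioi 0) := by
    refine ContinuousOn.div ?_ continuousOn_id fun t ht => ne_of_gt ht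
    exact ((cP.comp (continuous_const.sub continuous_id)).sub (cP.comp (continuous_const.add continuous_id))).continuousOn
  have hz := eqOn_zero_of_nonneg_of_integral_eq_zero hconti hnn (integrableOn_symmIntegrand_prim hc hodd hC ξ₀) hint0
  -- at t = ξ₀: P(0) − P(2ξ₀) = 0
  have h2 : P (2 * ξ₀) = 0 := by
    have h := hz (show ξ₀ ∈ Ioi (0:ℝ) from hξ₀)
    simp only [Pi.zero_apply, sub_self, div_eq_zero_iff] at h
    rcases h with h | h
    · have hP0 : P 0 = 0 := by simp [hP]
      rw [hP0, show ξ₀ + ξ₀ = 2 * ξ₀ by ring] at h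
      linarith
    · exact absurd h hξ₀.ne'
  -- ∫₀^{2ξ₀} (−Ω) = 0 with −Ω ≥ 0 continuous ⇒ Ω ≡ 0 a.e. on (0, 2ξ₀], hence on the open interval by continuity
  have hneg_int : ∫ u in (0:ℝ)..(2 * ξ₀), -Om u = 0 := by
    rw [intervalIntegral.integral_neg, neg_eq_zero]
    exact h2
  have hle : (0:ℝ) ≤ 2 * ξ₀ := by linarith
  have hnn' : 0 ≤ᵐ[volume.restrict (Ioc 0 (2 * ξ₀))] fun u => -Om u :=
    (ae_restrict_iff' measurableSet_Ioc).mpr (Eventually.of_forall fun u hu => by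
      have := hsign u hu.1; simp only [Pi.zero_apply]; linarith)
  have hae := (intervalIntegral.integral_eq_zero_iff_of_le_of_nonneg_ae hle hnn'
    ((hc.neg).intervalIntegrable _ _)).mp hneg_int
  have hae' : (fun u => -Om u) =ᵐ[volume.restrict (Ioo 0 (2 * ξ₀))] 0 :=
    ae_restrict_of_ae_restrict_of_subset Ioo_subset_Ioc_self hae
  have heq := Measure.eqOn_open_of_ae_eq hae' isOpen_Ioo (hc.neg).continuousOn continuousOn_const
  have hmem : ξ₀ ∈ Ioo 0 (2 * ξ₀) := ⟨hξ₀, by linarith⟩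
  have := heq hmem
  simp only [Pi.zero_apply, neg_eq_zero] at this
  exact this

end SheetHalfLine
end Summit.NavierStokesRegularity.OSWSelfSimilar
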